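import Literature.NumberTheory.LFunctions.WeilCombFamilyWeights
import Literature.NumberTheory.LFunctions.WeilCombNodeWeightsNode

/-!
# Crux `SignCone.ConeMagnification` (stmt-RiemannHypothesis-16303), line `Sketch` r9, stub `stub_combType` — sharp node evaluation I:
# the lattice / family reorganisation of a node weight (exact identity)

Backstop for the lead's wave 3 (seat-0 continues the worker's chain `WeilCombBumpPeriodization` / `WeilCombProgressionSums` /
`WeilCombFamilyWeights` if it stalls).  At a node `n` of the pair `(ℓ, ℓ')` the double tooth sum over `(k', k)` is reorganised
along the lattice `{(m, k') : ℓ ∣ nℓ'k' + g m}` (`g = gcd(nℓ', ℓ)`), i.e. `k = (nℓ'k' + g m)/ℓ`, family index `m ∈ ℤ`, and inside a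
family `k'` runs over the arithmetic progression `P ∣ m + Q k'` (`P = ℓ/g`, `Q = nℓ'/g`, coprime) of
`Literature.NumberTheory.LFunctions.abs_familySum_sub_integral_le`:

  `Σ_{k' ≤ K₁} Σ_{k ≤ M} B((log(nℓ'k'/ℓ) − log k)/h)/√(k k' n) = Σ_{|m| ≤ M₀} Σ_{k' ≤ K₁, P ∣ m + Qk'} B((log(nℓ'k'/ℓ) − log x)/h)/√(x k' n)`,
  `x = (nℓ'k' + g m)/ℓ`,

an EXACT identity once all teeth are full (`nℓ'K₁e^{2h} ≤ ℓM`) and the family range is large enough (`8h·nℓ'K₁ ≤ g M₀`): both sides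
are the sum over the common support (`B(y) ≠ 0 ⟹ |y| ≤ 2 ⟹ |ℓk − nℓ'k'| ≤ 8h·nℓ'k'`), by `Finset.sum_bij_ne_zero`.

* `CombType.family_reorg` — the identity.
-/

noncomputable section

-- `Summit.RiemannHypothesis.RiemannHypothesis.…` repeats a namespace component by design (D-0017 layout).
set_option linter.dupNamespace false

open scoped BigOperators
open MeasureTheory Set

namespace Summit.RiemannHypothesis.RiemannHypothesis.Theorems.SignConeConeMagnification

open Literature.NumberTheory.LFunctions

namespace CombType

/-- If `B` vanishes for `|y| > 2` and `B y ≠ 0` then `|y| ≤ 2`. [folklore] -/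
theorem abs_le_two_of_ne_zero {B : ℝ → ℝ} (hBs : ∀ x, 2 < |x| → B x = 0) {y : ℝ} (hy : B y ≠ 0) : |y| ≤ 2 :=
  not_lt.1 fun h => hy (hBs y h)

/-- `|log(v/u)| ≤ δ ≤ 1/2` (`u, v > 0`) ⟹ `|v − u| ≤ 2δu`. [folklore] -/
theorem abs_sub_le_of_abs_log_div_le {u v δ : ℝ} (hu : 0 < u) (hv : 0 < v) (hδ : δ ≤ 1 / 2)
    (h : |Real.log (v / u)| ≤ δ) : |v - u| ≤ 2 * δ * u := by
  have hδ0 : 0 ≤ δ := (abs_nonneg _).trans h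
  obtain ⟨h1, h2⟩ := abs_le.1 h
  have hvu : 0 < v / u := div_pos hv hu
  have huv : 0 < u / v := div_pos hu hv
  have e1 : 1 - u / v ≤ δ := by
    have := Real.one_sub_inv_le_log_of_pos hvu
    rw [inv_div] at this; linarith
  have e2 : 1 - v / u ≤ δ := by
    have := Real.one_sub_inv_le_log_of_pos huv
    rw [inv_div] at this
    have hlog : Real.log (u / v) = -Real.log (v / u) := by
      rw [← Real.log_inv, inv_div]
    linarith
  have f1 : v - u ≤ δ * v := by
    have := mul_le_mul_of_nonneg_left e1 hv.le
    rw [mul_sub, mul_one, mul_div_cancel₀ _ hv.ne'] at this; linarith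
  have f2 : u - v ≤ δ * u := by
    have := mul_le_mul_of_nonneg_left e2 hu.le
    rw [mul_sub, mul_one, mul_div_cancel₀ _ hu.ne'] at this; linarith
  have hv2 : v ≤ 2 * u := by nlinarith
  rw [abs_le]; constructor <;> nlinarith

/-- The tooth support in the original variables: if `B((log(a) − log k)/h) ≠ 0` (`a = nℓ'k'/ℓ > 0`, `k ≥ 1`, `0 < h ≤ 1/8`)
then `|ℓk − ℓa| ≤ 8h·ℓa` and `k ≤ a e^{2h}`. [folklore] -/
theorem tooth_support {B : ℝ → ℝ} (hBs : ∀ x, 2 < |x| → B x = 0) {h a x L₀ : ℝ} (hh : 0 < h) (hh8 : h ≤ 1 / 8)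
    (ha : 0 < a) (hx : 0 < x) (hL₀ : 0 < L₀) (hB : B ((Real.log a - Real.log x) / h) ≠ 0) :
    |L₀ * x - L₀ * a| ≤ 8 * h * (L₀ * a) ∧ x ≤ a * Real.exp (2 * h) := by
  have h2 := abs_le_two_of_ne_zero hBs hB
  rw [← Real.log_div ha.ne' hx.ne', abs_div, abs_of_pos hh, div_le_iff₀ hh] at h2
  constructor
  · have hsub := abs_sub_le_of_abs_log_div_le hx ha (by linarith) h2
    -- `|a − x| ≤ 4h x` and `x ≤ 2a`
    have hx2 : x ≤ 2 * a := by
      have := (abs_le.1 hsub).1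
      nlinarith
    rw [← mul_sub, abs_mul, abs_of_pos hL₀, abs_sub_comm]
    calc L₀ * |a - x| ≤ L₀ * (2 * (2 * h) * x) := mul_le_mul_of_nonneg_left hsub hL₀.le
      _ ≤ L₀ * (2 * (2 * h) * (2 * a)) := by
          refine mul_le_mul_of_nonneg_left (mul_le_mul_of_nonneg_left hx2 (by positivity)) hL₀.le
      _ = 8 * h * (L₀ * a) := by ring
  · have hlow := (abs_le.1 h2).1
    have e1 : Real.log (x / a) ≤ 2 * h := by
      rw [Real.log_div hx.ne' ha.ne']
      rw [Real.log_div ha.ne' hx.ne'] at hlow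
      linarith
    have e2 := Real.exp_le_exp.2 e1
    rw [Real.exp_log (div_pos hx ha), div_le_iff₀ ha] at e2
    linarith

/-- **The family reorganisation of a node weight** (exact).  See the module docstring. [folklore] -/
theorem family_reorg {B : ℝ → ℝ} (hBs : ∀ x, 2 < |x| → B x = 0) {h : ℝ} (hh : 0 < h) (hh8 : h ≤ 1 / 8)
    {n ℓ ℓ' K₁ M M₀ : ℕ} (hn : 1 ≤ n) (hℓ : 1 ≤ ℓ) (hℓ' : 1 ≤ ℓ')
    (hK₁ : (n : ℝ) * ℓ' * K₁ * Real.exp (2 * h) ≤ ℓ * M)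
    (hM₀ : 8 * h * n * ℓ' * K₁ ≤ Nat.gcd (n * ℓ') ℓ * M₀) :
    ∑ k' ∈ Finset.Icc 1 K₁, (∑ k ∈ Finset.Icc 1 M,
        B ((Real.log ((n : ℝ) * ℓ' * k' / ℓ) - Real.log k) / h) / Real.sqrt k) / Real.sqrt k' / Real.sqrt n
      = ∑ m ∈ Finset.Icc (-(M₀ : ℤ)) M₀,
          ∑ k' ∈ (Finset.Icc 1 K₁).filter
              (fun k' : ℕ => ((ℓ / Nat.gcd (n * ℓ') ℓ : ℕ) : ℤ) ∣ m + ((n * ℓ' / Nat.gcd (n * ℓ') ℓ : ℕ) : ℤ) * k'),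
            B ((Real.log ((n : ℝ) * ℓ' * k' / ℓ) - Real.log (((n : ℝ) * ℓ' * k' + Nat.gcd (n * ℓ') ℓ * m) / ℓ)) / h)
              / Real.sqrt (((n : ℝ) * ℓ' * k' + Nat.gcd (n * ℓ') ℓ * m) / ℓ) / Real.sqrt k' / Real.sqrt n := by
  classical
  -- names
  set g : ℕ := Nat.gcd (n * ℓ') ℓ with hg
  have hg0 : g ≠ 0 := (Nat.gcd_pos_of_pos_right _ (by omega)).ne'
  have hgℓ : g ∣ ℓ := Nat.gcd_dvd_right _ _
  have hga : g ∣ n * ℓ' := Nat.gcd_dvd_left _ _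
  set P : ℕ := ℓ / g with hP
  set Q : ℕ := n * ℓ' / g with hQ
  have hP' : (P : ℤ) * g = ℓ := by exact_mod_cast Nat.div_mul_cancel hgℓ
  have hQ' : (Q : ℤ) * g = (n : ℤ) * ℓ' := by exact_mod_cast Nat.div_mul_cancel hga
  have hg0Z : (g : ℤ) ≠ 0 := by exact_mod_cast hg0
  have hg0R : ((g : ℤ) : ℝ) ≠ 0 := by exact_mod_cast hg0
  have hℓ0 : (0 : ℝ) < ℓ := by exact_mod_cast hℓ
  have hn0 : (0 : ℝ) < n := by exact_mod_cast hn
  have hℓ'0 : (0 : ℝ) < ℓ' := by exact_mod_cast hℓ'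
  have hgR : (0 : ℝ) < g := by exact_mod_cast Nat.pos_of_ne_zero hg0
  have hgd : ∀ k' k : ℕ, (g : ℤ) ∣ (ℓ : ℤ) * k - (n : ℤ) * ℓ' * k' := fun k' k => by
    refine dvd_sub (dvd_mul_of_dvd_left (by exact_mod_cast hgℓ) _) ?_
    have : (g : ℤ) ∣ (n : ℤ) * ℓ' := by exact_mod_cast hga
    exact dvd_mul_of_dvd_left this _
  -- the tooth function of `k'` and a real abscissa `x`
  set T : ℕ → ℝ → ℝ := fun k' x =>
    B ((Real.log ((n : ℝ) * ℓ' * k' / ℓ) - Real.log x) / h) / Real.sqrt x / Real.sqrt k' / Real.sqrt n with hT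
  have hTB : ∀ k' x, T k' x ≠ 0 → B ((Real.log ((n : ℝ) * ℓ' * k' / ℓ) - Real.log x) / h) ≠ 0 := by
    intro k' x hne h0; apply hne; simp only [hT, h0, zero_div]
  -- both sides as sums over finsets of pairs
  have hL : ∑ k' ∈ Finset.Icc 1 K₁, (∑ k ∈ Finset.Icc 1 M,
      B ((Real.log ((n : ℝ) * ℓ' * k' / ℓ) - Real.log k) / h) / Real.sqrt k) / Real.sqrt k' / Real.sqrt n
      = ∑ p ∈ Finset.Icc 1 K₁ ×ˢ Finset.Icc 1 M, T p.1 p.2 := by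
    rw [Finset.sum_product]
    refine Finset.sum_congr rfl fun k' _ => ?_
    rw [Finset.sum_div, Finset.sum_div]
  have hR : ∑ m ∈ Finset.Icc (-(M₀ : ℤ)) M₀, ∑ k' ∈ (Finset.Icc 1 K₁).filter
        (fun k' : ℕ => (P : ℤ) ∣ m + (Q : ℤ) * k'),
        B ((Real.log ((n : ℝ) * ℓ' * k' / ℓ) - Real.log (((n : ℝ) * ℓ' * k' + g * m) / ℓ)) / h)
          / Real.sqrt (((n : ℝ) * ℓ' * k' + g * m) / ℓ) / Real.sqrt k' / Real.sqrt n
      = ∑ q ∈ (Finset.Icc (-(M₀ : ℤ)) M₀ ×ˢ Finset.Icc 1 K₁).filter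
          (fun q : ℤ × ℕ => (P : ℤ) ∣ q.1 + (Q : ℤ) * q.2), T q.2 (((n : ℝ) * ℓ' * q.2 + g * q.1) / ℓ) := by
    rw [Finset.sum_filter, Finset.sum_product]
    refine Finset.sum_congr rfl fun m _ => ?_
    rw [Finset.sum_filter]
  rw [hL, hR]
  -- the bijection between the supports: `(k', k) ↦ (m, k')`, `m = (ℓk − nℓ'k')/g`
  refine Finset.sum_bij_ne_zero (fun p _ _ => ((((ℓ : ℤ) * p.2 - (n : ℤ) * ℓ' * p.1) / g), p.1)) ?_ ?_ ?_ ?_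
  · -- membership
    rintro ⟨k', k⟩ hp hne
    simp only [Finset.mem_product, Finset.mem_Icc] at hp
    obtain ⟨⟨hk'1, hk'K⟩, hk1, -⟩ := hp
    have hk'0 : (0 : ℝ) < k' := by exact_mod_cast hk'1
    have hk0 : (0 : ℝ) < k := by exact_mod_cast hk1
    have ha0 : (0 : ℝ) < (n : ℝ) * ℓ' * k' / ℓ := by positivity
    simp only [Finset.mem_filter, Finset.mem_product, Finset.mem_Icc]
    refine ⟨⟨?_, hk'1, hk'K⟩, ?_⟩
    · -- `|m| ≤ M₀` from the support of `B`
      obtain ⟨hsup, -⟩ := tooth_support hBs hh hh8 ha0 hk0 hℓ0 (hTB _ _ hne)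
      have e : (ℓ : ℝ) * ((n : ℝ) * ℓ' * k' / ℓ) = (n : ℝ) * ℓ' * k' := by field_simp
      rw [e] at hsup
      have hk'K' : (k' : ℝ) ≤ K₁ := by exact_mod_cast hk'K
      have hbound : |(ℓ : ℝ) * k - (n : ℝ) * ℓ' * k'| ≤ g * M₀ :=
        calc |(ℓ : ℝ) * k - (n : ℝ) * ℓ' * k'| ≤ 8 * h * ((n : ℝ) * ℓ' * k') := hsup
          _ ≤ 8 * h * ((n : ℝ) * ℓ' * K₁) := by
              refine mul_le_mul_of_nonneg_left (mul_le_mul_of_nonneg_left hk'K' (by positivity)) (by positivity)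
          _ = 8 * h * n * ℓ' * K₁ := by ring
          _ ≤ g * M₀ := hM₀
      have hcast : (((((ℓ : ℤ) * k - (n : ℤ) * ℓ' * k') / g : ℤ)) : ℝ) = ((ℓ : ℝ) * k - (n : ℝ) * ℓ' * k') / g := by
        rw [Int.cast_div (hgd k' k) hg0R]; push_cast; ring
      have hmR : |(((((ℓ : ℤ) * k - (n : ℤ) * ℓ' * k') / g : ℤ)) : ℝ)| ≤ M₀ := by
        rw [hcast, abs_div, abs_of_pos hgR, div_le_iff₀ hgR, mul_comm (M₀ : ℝ)]
        exact hbound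
      obtain ⟨h1, h2⟩ := abs_le.1 hmR
      exact ⟨by exact_mod_cast h1, by exact_mod_cast h2⟩
    · -- the progression condition: `m + Q k' = P k`
      have e : ((ℓ : ℤ) * k - (n : ℤ) * ℓ' * k') / g + (Q : ℤ) * k' = (P : ℤ) * k := by
        have : ((ℓ : ℤ) * k - (n : ℤ) * ℓ' * k') = ((P : ℤ) * k - (Q : ℤ) * k') * g := by
          linear_combination (-(k : ℤ)) * hP' + (k' : ℤ) * hQ'
        rw [this, Int.mul_ediv_cancel _ hg0Z]; ring
      rw [e]; exact dvd_mul_right _ _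
  · -- injectivity
    rintro ⟨k₁', k₁⟩ h₁ _ ⟨k₂', k₂⟩ h₂ _ heq
    simp only [Prod.mk.injEq] at heq
    obtain ⟨hm, hk'⟩ := heq
    subst hk'
    have := (Int.ediv_left_inj (hgd k₁' k₁) (hgd k₁' k₂)).1 hm
    have hℓZ : (ℓ : ℤ) ≠ 0 := by exact_mod_cast (by omega : ℓ ≠ 0)
    have hkk : (k₁ : ℤ) = k₂ := mul_left_cancel₀ hℓZ (by linarith)
    have hkk' : k₁ = k₂ := by exact_mod_cast hkk
    rw [hkk']
  · -- surjectivity onto the support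
    rintro ⟨m, k'⟩ hq hne
    simp only [Finset.mem_filter, Finset.mem_product, Finset.mem_Icc] at hq
    obtain ⟨⟨-, hk'1, hk'K⟩, hdvd⟩ := hq
    have hk'0 : (0 : ℝ) < k' := by exact_mod_cast hk'1
    -- `ℓ ∣ nℓ'k' + g m`
    have hℓd : (ℓ : ℤ) ∣ (n : ℤ) * ℓ' * k' + g * m := by
      obtain ⟨t, ht⟩ := hdvd
      refine ⟨t, ?_⟩
      calc (n : ℤ) * ℓ' * k' + g * m = g * (m + (Q : ℤ) * k') := by rw [← hQ']; ring
        _ = g * ((P : ℤ) * t) := by rw [ht]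
        _ = ℓ * t := by rw [← hP']; ring
    obtain ⟨k, hk⟩ := hℓd
    have hx : ((n : ℝ) * ℓ' * k' + g * m) / ℓ = ((k : ℤ) : ℝ) := by
      rw [div_eq_iff hℓ0.ne']
      have := congrArg (fun z : ℤ => (z : ℝ)) hk
      push_cast at this
      linarith
    have hne' : T k' ((k : ℤ) : ℝ) ≠ 0 := by
      have : T (m, k').2 (((n : ℝ) * ℓ' * (m, k').2 + g * (m, k').1) / ℓ) = T k' ((k : ℤ) : ℝ) := by
        simp only [hx]
      rwa [this] at hne
    -- `k ≥ 1`: otherwise `√k = 0`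
    have hkpos : 0 < k := by
      by_contra hk0
      push Not at hk0
      apply hne'
      have : Real.sqrt ((k : ℤ) : ℝ) = 0 := Real.sqrt_eq_zero'.2 (by exact_mod_cast hk0)
      simp only [hT, this, div_zero, zero_div]
    have hkR : (0 : ℝ) < ((k : ℤ) : ℝ) := by exact_mod_cast hkpos
    have ha0 : (0 : ℝ) < (n : ℝ) * ℓ' * k' / ℓ := by positivity
    -- `k ≤ M` from the support of `B`
    obtain ⟨-, hkexp⟩ := tooth_support hBs hh hh8 ha0 hkR hℓ0 (hTB _ _ hne')
    have hkM : ((k : ℤ) : ℝ) ≤ M := by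
      refine hkexp.trans ?_
      have hk'K' : (k' : ℝ) ≤ K₁ := by exact_mod_cast hk'K
      have hmono : (n : ℝ) * ℓ' * k' / ℓ ≤ (n : ℝ) * ℓ' * K₁ / ℓ :=
        div_le_div_of_nonneg_right (mul_le_mul_of_nonneg_left hk'K' (by positivity)) hℓ0.le
      calc (n : ℝ) * ℓ' * k' / ℓ * Real.exp (2 * h) ≤ (n : ℝ) * ℓ' * K₁ / ℓ * Real.exp (2 * h) :=
            mul_le_mul_of_nonneg_right hmono (Real.exp_pos _).le
        _ = (n : ℝ) * ℓ' * K₁ * Real.exp (2 * h) / ℓ := by ring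
        _ ≤ M := by rw [div_le_iff₀ hℓ0]; linarith
    set kN : ℕ := k.toNat with hkN
    have hkk : (kN : ℤ) = k := Int.toNat_of_nonneg hkpos.le
    have hkRr : ((kN : ℕ) : ℝ) = ((k : ℤ) : ℝ) := by exact_mod_cast hkk
    refine ⟨(k', kN), ?_, ?_, ?_⟩
    · simp only [Finset.mem_product, Finset.mem_Icc]
      refine ⟨⟨hk'1, hk'K⟩, ?_, ?_⟩
      · have : (1 : ℤ) ≤ kN := by rw [hkk]; omega
        exact_mod_cast this
      · have : ((kN : ℕ) : ℝ) ≤ M := by rw [hkRr]; exact hkM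
        exact_mod_cast this
    · show T k' ((kN : ℕ) : ℝ) ≠ 0
      rwa [hkRr]
    · simp only [Prod.mk.injEq, and_true]
      rw [hkk, ← hk]
      rw [show (n : ℤ) * ℓ' * k' + g * m - (n : ℤ) * ℓ' * k' = m * g by ring, Int.mul_ediv_cancel _ hg0Z]
  · -- the values agree
    rintro ⟨k', k⟩ _ _
    have hx : ((n : ℝ) * ℓ' * k' + g * (((((ℓ : ℤ) * k - (n : ℤ) * ℓ' * k') / g : ℤ)) : ℝ)) / ℓ = (k : ℝ) := by
      rw [Int.cast_div (hgd k' k) hg0R]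
      push_cast
      field_simp
      ring
    show T k' (k : ℝ) = T k' _
    rw [hx]

/-- **Anchor `combTypeFamilyReorg`** (registered sub-goal; `family_reorg` with explicit quantifiers): the lattice/family
reorganisation of a node weight. [folklore] -/
theorem combTypeFamilyReorg : ∀ B : ℝ → ℝ, (∀ x, 2 < |x| → B x = 0) → ∀ h : ℝ, (0 < h) → (h ≤ 1 / 8) → ∀ n ℓ ℓ' K₁ M M₀ : ℕ, (1 ≤ n) → (1 ≤ ℓ) → (1 ≤ ℓ') → ((n : ℝ) * ℓ' * K₁ * Real.exp (2 * h) ≤ ℓ * M) → (8 * h * n * ℓ' * K₁ ≤ Nat.gcd (n * ℓ') ℓ * M₀) → ∑ k' ∈ Finset.Icc 1 K₁, (∑ k ∈ Finset.Icc 1 M, B ((Real.log ((n : ℝ) * ℓ' * k' / ℓ) - Real.log k) / h) / Real.sqrt k) / Real.sqrt k' / Real.sqrt n = ∑ m ∈ Finset.Icc (-(M₀ : ℤ)) M₀, ∑ k' ∈ (Finset.Icc 1 K₁).filter (fun k' : ℕ => ((ℓ / Nat.gcd (n * ℓ') ℓ : ℕ) : ℤ) ∣ m + ((n * ℓ' /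 Nat.gcd (n * ℓ') ℓ : ℕ) : ℤ) * k'), B ((Real.log ((n : ℝ) * ℓ' * k' / ℓ) - Real.log (((n : ℝ) * ℓ' * k' + Nat.gcd (n * ℓ') ℓ * m) / ℓ)) / h) / Real.sqrt (((n : ℝ) * ℓ' * k' + Nat.gcd (n * ℓ') ℓ * m) / ℓ) / Real.sqrt k' / Real.sqrt n :=
  fun _ hBs _ hh hh8 _ _ _ _ _ _ hn hℓ hℓ' hK₁ hM₀ => family_reorg hBs hh hh8 hn hℓ hℓ' hK₁ hM₀

end CombType

end Summit.RiemannHypothesis.RiemannHypothesis.Theorems.SignConeConeMagnification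

end
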